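import Mathlib
import Summits.NavierStokesRegularity.NavierStokesRegularity.Theorems.RootDecompLitSliceGeneralWindowTradeoffStubWindowHardy
import Summits.NavierStokesRegularity.NavierStokesRegularity.Theorems.RootDecompLitSliceSupRateClockScarLaw
import HarnessLib

/-!
# Route RootDecompLitSlice — cell Uᶜ `CritTameScarIsCritical` (stmt-NavierStokesRegularity-31733):
# the LOCAL free-window scar–modulus trade-off STℓ (local Hardy with a cut-off)

Helpers toward the Tao-vacuous cell Uᶜ (`--supports 31733`; no item, no node, no registered stub).
The landed global trade-off STg `generalWindowTradeoff`
(`∫_{B_r(x₀)}|u(T)|² ≤ 2H + 8‖u₀‖₂ν⁻¹(r²/τ)√H`) pays the local mass of a good slice `u(t)` with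
the GLOBAL dissipation over the window `[T−τ,T)` (Hardy on balls against `∫_{ℝ³}|∇u(t)|²`, then the
global energy drop). STℓ is the same trade-off with the dissipation budget LOCALISED to the ball
`B_ρ(x₀)`, `ρ ≥ 4r`, at the price of a tail term of relative size `(r/ρ)²`:

* `LocalWindowTradeoff.localHardyBall` — LOCAL HARDY ON BALLS: one universal `c₀ ≥ 0` with
  `∫_{B_r(x₀)}|f|² ≤ 4r²[(1+η)∫_{B_ρ(x₀)}|Df|²_F + (1+η⁻¹)(c₀/ρ²)∫_{B_ρ(x₀)}|f|²]` for every
  `C¹` field `f` of `ℝ³`, `0 < r`, `4r ≤ ρ`, `η > 0` (the ball step `HardyBall.lintegral_ball_le_of_cutoff`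
  with the scaled cut-off `χ_{ρ/4}(· − x₀)·f`, supported in `B̄_{ρ/2}(x₀)`, and the Leibniz bound
  `HardyBall.frobeniusNormSq_leibniz_le`; no global `L²` hypothesis);
* `LocalWindowTradeoff.localMass_le_sq_sqrt_add` / `LocalWindowTradeoff.localRelease_le` — the
  sharp approximation principle `∫_{B_r}|u(T)|² ≤ (√H + √B)²` and the LOCAL ENERGY RELEASE bound
  `∫_{B_r(x₀)}|u(t)|² − ∫_{B_r(x₀)}|u(T)|² ≤ H + 2√H·(∫_{B_r(x₀)}|u(T)|²)^{1/2}` for `L²` fields with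
  `∫|u(t)−u(T)|² ≤ H` (the `b`-free local form of the energy-drop-versus-modulus bound: what a window
  slice can release above the terminal profile inside a ball);
* `LocalWindowTradeoff.localWindowTradeoff` — STℓ: on the classical Leray–Hopf frame, a window
  modulus `∫|u(t)−u(T)|² ≤ H` on `[T−τ,T)` and a LOCAL DISSIPATION BUDGET
  `ν∫_{T−τ}^{T}∫_{B_ρ(x₀)}|∇u|²_F ≤ L` (classical gradient, `[0,∞]`-valued) give
  `∫_{B_r(x₀)}|u(T)|² ≤ 2H + 16(r²/(ντ))·L + c₀(r/ρ)²·(H + ∫_{B_ρ(x₀)}|u(T)|²)`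
  for `0 < r`, `4r ≤ ρ`, `0 < τ < T` (a slice `t` with `∫_{B_ρ}|∇u(t)|² ≲ L/(ντ)` by the mean value
  in time, local Hardy at `t` with `η = 1`, and the approximation principle
  `SupRateClockScarLaw.scar_le_two_clock_add_two_localMass` twice).

THE NUMBER `L` IS A HYPOTHESIS, exactly like `H` in STg (critic row 665 (c3)): its discharge is the
local energy inequality on `B_ρ(x₀) × [T−τ,T)`,
`L ≤ ½·(local energy release) + F₃ + F₄ + F₅` (`F₃ = ν∫∫|u|²|Δφ|`, `F₄ = ∫∫|u|²|u·∇φ|` the cubic flux,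
`F₅ = 2∫∫|p||u·∇φ|` the pressure flux through the annulus), which is NOT proved here. Substrate for
that step exists in part: `Literature.Analysis.FluidPDE.IsClassicalNSSolutionOnRegion.isSuitableWeakSolutionOn`
(classical solutions on open space–time regions are CKN-suitable, integrated LEI with the classical
pressure); missing are the terminal-window (slice) form of the LEI and, for bounding `F₅`, the Riesz
representation `p = ℛᵢℛⱼ(uᵢuⱼ) + c(t)` of the classical pressure on `ℝ³` (in the tree only for Kato
solutions, `IsKatoSolutionOn.exists_rieszPressure_suitable_slab`).

WHY (the flux-starved Tier 1 of the writer's σ-programme, FLUXSTARVED-g38 §2–§4, cleared on paper by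
critic row 665 (c1)): with `ρ = r^θ`, `θ < 1`, the tail is `O(r^{2−2θ})`-small relative to the
global law and `L` is fed only by what crosses the annulus; STℓ is the b-free kernel of that bootstrap.

HONEST FRAMING: helper lemmas INSIDE the Tao-vacuous cell Uᶜ; zero load of the route moves
(ROOT ⟺ U ∧ P1, critic rows 354/371/563/639/665); no item is re-typed. Rung 0: nothing here proves
NS regularity. Decomp-ns route-writer g39. [folklore]
-/

set_option linter.dupNamespace false

noncomputable section

namespace Summit.NavierStokesRegularity.NavierStokesRegularity.Theorems

open MeasureTheory Set Metric Filter Topology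
open scoped ENNReal NNReal
open Literature.Analysis.FluidPDE
open GeneralWindowTradeoff GeneralWindowTradeoff.HardyBall GeneralWindowTradeoff.WindowReduction
  GeneralWindowTradeoff.EnergyDrop

namespace LocalWindowTradeoff

/-- ★ **LOCAL HARDY ON BALLS** (cut-off version of `hardyBall`, no global `L²` hypothesis): there is a
universal `c₀ ≥ 0` such that for every `C¹` field `f : ℝ³ → ℝ³`, every centre `x₀`, `0 < r`,
`4r ≤ ρ` and `η > 0`,
`∫_{B_r(x₀)}|f|² ≤ 4r²·[(1+η)∫_{B_ρ(x₀)}|Df|²_F + (1+η⁻¹)(c₀/ρ²)∫_{B_ρ(x₀)}|f|²]`.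
Proof: the ball step of Hardy's inequality for the truncation `ψ = χ_{ρ/4}(·−x₀)·f ∈ C¹_c`
(`ψ = f` on `B_r`, `supp ψ ⊆ B̄_{ρ/2}(x₀)`, `|Dχ| ≤ 8C₁/ρ`) and the `η`-Young–Leibniz bound;
`c₀ = 192C₁²`. [folklore] -/
theorem localHardyBall : ∃ c₀ : ℝ, 0 ≤ c₀ ∧
    ∀ (f : EuclideanSpace ℝ (Fin 3) → EuclideanSpace ℝ (Fin 3)), ContDiff ℝ 1 f →
    ∀ (x₀ : EuclideanSpace ℝ (Fin 3)) (r ρ η : ℝ), 0 < r → 4 * r ≤ ρ → 0 < η →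
      ∫ y in ball x₀ r, ‖f y‖ ^ 2 ≤
        4 * r ^ 2 * ((1 + η) * (∫ y in ball x₀ ρ, frobeniusNormSq (fderiv ℝ f y)) +
          (1 + η⁻¹) * (c₀ / ρ ^ 2) * ∫ y in ball x₀ ρ, ‖f y‖ ^ 2) := by
  obtain ⟨χ, C₁, hC₁, hχ⟩ :=
    Literature.Analysis.Calculus.exists_scaled_cutoff (E := EuclideanSpace ℝ (Fin 3))
  refine ⟨192 * C₁ ^ 2, by positivity, ?_⟩
  intro f hf x₀ r ρ η hr hρ hη
  -- the cut-off scale `k = ρ/4 ≥ r`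
  obtain ⟨k, hkdef⟩ : ∃ k : ℝ, k = ρ / 4 := ⟨_, rfl⟩
  have hk : r ≤ k := by rw [hkdef]; linarith
  have hk0 : 0 < k := hr.trans_le hk
  have hρ0 : 0 < ρ := by linarith
  have hconst : 3 * (2 * C₁ / k) ^ 2 = 192 * C₁ ^ 2 / ρ ^ 2 := by
    rw [hkdef]; field_simp; ring
  obtain ⟨hcC1, hc0, hc1, hcone, hczero, hcDin, hcDout⟩ := hχ k hk0
  have hfd : ∀ y, HasFDerivAt f (fderiv ℝ f y) y := fun y =>
    ((hf.differentiable one_ne_zero) y).hasFDerivAt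
  -- the truncated field
  set c : EuclideanSpace ℝ (Fin 3) → ℝ := fun y => χ k (y - x₀) with hcdef
  set ψ : EuclideanSpace ℝ (Fin 3) → EuclideanSpace ℝ (Fin 3) := fun y => c y • f y with hψdef
  have hcC1' : ContDiff ℝ 1 c := hcC1.comp (contDiff_id.sub contDiff_const)
  have hψC1 : ContDiff ℝ 1 ψ := hcC1'.smul hf
  have hψc : HasCompactSupport ψ := by
    refine HasCompactSupport.intro (isCompact_closedBall x₀ (2 * k)) fun y hy => ?_
    have hy' : 2 * k ≤ ‖y - x₀‖ := by
      rw [mem_closedBall, dist_eq_norm] at hy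
      exact (not_le.1 hy).le
    simp [hψdef, hcdef, hczero _ hy']
  have hagree : ∀ y ∈ ball x₀ r, ψ y = f y := by
    intro y hy
    have hy' : ‖y - x₀‖ ≤ k := by
      rw [mem_ball, dist_eq_norm] at hy
      exact hy.le.trans hk
    simp [hψdef, hcdef, hcone _ hy']
  -- derivative of the cut-off and its bound `‖Dc‖ ≤ 2C₁/k`
  have hcd : ∀ y, HasFDerivAt c (fderiv ℝ (χ k) (y - x₀)) y := by
    intro y
    have h1 : HasFDerivAt (fun y : EuclideanSpace ℝ (Fin 3) => y - x₀)
        (ContinuousLinearMap.id ℝ (EuclideanSpace ℝ (Fin 3))) y :=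
      (hasFDerivAt_id y).sub_const x₀
    have h2 : HasFDerivAt (χ k) (fderiv ℝ (χ k) (y - x₀)) (y - x₀) :=
      ((hcC1.differentiable one_ne_zero) _).hasFDerivAt
    have := h2.comp y h1
    rwa [ContinuousLinearMap.comp_id] at this
  have hDc : ∀ y, ‖fderiv ℝ (χ k) (y - x₀)‖ ≤ 2 * C₁ / k := by
    intro y
    rcases lt_or_ge ‖y - x₀‖ k with hlt | hge
    · rw [hcDin _ hlt, norm_zero]
      positivity
    · exact (hcDout _ hge).trans (div_le_div_of_nonneg_left (by positivity) hk0 hge)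
  -- the Leibniz rule and the pointwise gradient bound
  have hψd : ∀ y, HasFDerivAt ψ
      (c y • fderiv ℝ f y + (fderiv ℝ (χ k) (y - x₀)).smulRight (f y)) y :=
    fun y => (hcd y).smul (hfd y)
  have hpt : ∀ y, frobeniusNormSq (fderiv ℝ ψ y) ≤
      (1 + η) * frobeniusNormSq (fderiv ℝ f y) +
        (1 + η⁻¹) * (192 * C₁ ^ 2 / ρ ^ 2) * ‖f y‖ ^ 2 := by
    intro y
    rw [(hψd y).fderiv]
    have h := frobeniusNormSq_leibniz_le (hc0 (y - x₀)) (hc1 (y - x₀)) hη (fderiv ℝ f y)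
      (fderiv ℝ (χ k) (y - x₀)) (hDc y) (f y)
    rw [hconst] at h
    simpa only [hcdef, mul_assoc] using h
  -- `Dψ` vanishes off the closed ball `B̄_{2k}(x₀) ⊆ B_ρ(x₀)`
  have hsub : closedBall x₀ (2 * k) ⊆ ball x₀ ρ :=
    closedBall_subset_ball (by rw [hkdef]; linarith)
  have hψzero : ∀ y, y ∉ ball x₀ ρ → frobeniusNormSq (fderiv ℝ ψ y) = 0 := by
    intro y hy
    have hy2 : y ∉ closedBall x₀ (2 * k) := fun h => hy (hsub h)
    have hy' : 2 * k < dist y x₀ := by rwa [mem_closedBall, not_le] at hy2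
    have hev : ψ =ᶠ[𝓝 y] fun _ => 0 := by
      have hopen : IsOpen {z : EuclideanSpace ℝ (Fin 3) | 2 * k < dist z x₀} :=
        isOpen_lt continuous_const (continuous_id.dist continuous_const)
      filter_upwards [hopen.mem_nhds hy'] with z hz
      have hz' : 2 * k ≤ ‖z - x₀‖ := by
        rw [← dist_eq_norm]; exact le_of_lt hz
      simp [hψdef, hcdef, hczero _ hz']
    rw [hev.fderiv_eq, fderiv_const_apply]
    simp [frobeniusNormSq]
  have hint_eq : ∫ y in ball x₀ ρ, frobeniusNormSq (fderiv ℝ ψ y) =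
      ∫ y, frobeniusNormSq (fderiv ℝ ψ y) :=
    setIntegral_eq_integral_of_forall_compl_eq_zero hψzero
  -- integrability on the ball (continuous integrands)
  have hFc : Continuous fun y => frobeniusNormSq (fderiv ℝ f y) := by
    simp only [frobeniusNormSq]
    exact continuous_finsetSum _ fun i _ =>
      (((hf.continuous_fderiv one_ne_zero).clm_apply continuous_const).norm.pow 2)
  have hψFc : Continuous fun y => frobeniusNormSq (fderiv ℝ ψ y) := by
    simp only [frobeniusNormSq]
    exact continuous_finsetSum _ fun i _ =>
      (((hψC1.continuous_fderiv one_ne_zero).clm_apply continuous_const).norm.pow 2)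
  have hMc : Continuous fun y => ‖f y‖ ^ 2 := (hf.continuous.norm).pow 2
  have hFi : Integrable (fun y => frobeniusNormSq (fderiv ℝ f y)) (volume.restrict (ball x₀ ρ)) :=
    (hFc.continuousOn.integrableOn_compact (isCompact_closedBall x₀ ρ)).mono_set
      ball_subset_closedBall
  have hψFi : Integrable (fun y => frobeniusNormSq (fderiv ℝ ψ y))
      (volume.restrict (ball x₀ ρ)) :=
    (hψFc.continuousOn.integrableOn_compact (isCompact_closedBall x₀ ρ)).mono_set
      ball_subset_closedBall
  have hMi : Integrable (fun y => ‖f y‖ ^ 2) (volume.restrict (ball x₀ ρ)) :=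
    (hMc.continuousOn.integrableOn_compact (isCompact_closedBall x₀ ρ)).mono_set
      ball_subset_closedBall
  have hFnn : ∀ y, 0 ≤ frobeniusNormSq (fderiv ℝ f y) := fun y => frobeniusNormSq_nonneg _
  have hI1 : 0 ≤ ∫ y in ball x₀ ρ, frobeniusNormSq (fderiv ℝ f y) :=
    integral_nonneg fun y => hFnn y
  have hI2 : 0 ≤ ∫ y in ball x₀ ρ, ‖f y‖ ^ 2 := integral_nonneg fun _ => sq_nonneg _
  -- integrate the pointwise bound over `B_ρ(x₀)`
  have hRi : Integrable (fun y => (1 + η) * frobeniusNormSq (fderiv ℝ f y) +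
      (1 + η⁻¹) * (192 * C₁ ^ 2 / ρ ^ 2) * ‖f y‖ ^ 2) (volume.restrict (ball x₀ ρ)) :=
    (hFi.const_mul _).add (hMi.const_mul _)
  have hint : ∫ y, frobeniusNormSq (fderiv ℝ ψ y) ≤
      (1 + η) * (∫ y in ball x₀ ρ, frobeniusNormSq (fderiv ℝ f y)) +
        (1 + η⁻¹) * (192 * C₁ ^ 2 / ρ ^ 2) * ∫ y in ball x₀ ρ, ‖f y‖ ^ 2 := by
    rw [← hint_eq]
    refine (integral_mono hψFi hRi fun y => hpt y).trans (le_of_eq ?_)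
    rw [integral_add (hFi.const_mul _) (hMi.const_mul _), integral_const_mul, integral_const_mul]
  -- the ball step for the truncation
  have hball := lintegral_ball_le_of_cutoff f ψ hψC1 hψc x₀ hagree
  have hRHS0 : 0 ≤ (1 + η) * (∫ y in ball x₀ ρ, frobeniusNormSq (fderiv ℝ f y)) +
      (1 + η⁻¹) * (192 * C₁ ^ 2 / ρ ^ 2) * ∫ y in ball x₀ ρ, ‖f y‖ ^ 2 :=
    add_nonneg (mul_nonneg (by linarith) hI1) (mul_nonneg (by positivity) hI2)
  have hX : ∫⁻ y in ball x₀ r, ‖f y‖ₑ ^ 2 ≤ ENNReal.ofReal (4 * r ^ 2 *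
      ((1 + η) * (∫ y in ball x₀ ρ, frobeniusNormSq (fderiv ℝ f y)) +
        (1 + η⁻¹) * (192 * C₁ ^ 2 / ρ ^ 2) * ∫ y in ball x₀ ρ, ‖f y‖ ^ 2)) := by
    refine hball.trans ?_
    rw [← ENNReal.ofReal_mul (sq_nonneg _)]
    refine ENNReal.ofReal_le_ofReal ?_
    have hr2 : 0 ≤ r ^ 2 := sq_nonneg _
    nlinarith [mul_le_mul_of_nonneg_left hint hr2]
  -- back to the real set integral on `B_r(x₀)`
  have hLHS : ∫ y in ball x₀ r, ‖f y‖ ^ 2 = (∫⁻ y in ball x₀ r, ‖f y‖ₑ ^ 2).toReal := by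
    rw [integral_eq_lintegral_of_nonneg_ae (Filter.Eventually.of_forall fun y => sq_nonneg _)
      hMc.aestronglyMeasurable]
    congr 1
    refine lintegral_congr fun y => ?_
    rw [← ofReal_norm, ENNReal.ofReal_pow (norm_nonneg _)]
  rw [hLHS]
  exact ENNReal.toReal_le_of_le_ofReal (by positivity) hX

/-- The SHARP approximation principle (cf. `SupRateClockScarLaw.scar_le_two_clock_add_two_localMass`,
which weakens the right-hand side to `2H + 2B`): for `L²` fields `uT, ut` of `ℝ³`,
`∫⁻‖ut − uT‖ₑ² ≤ H` and `∫_{B_r(x₀)}‖ut‖² ≤ B` give `∫_{B_r(x₀)}‖uT‖² ≤ (√H + √B)²`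
(triangle inequality in `L²(B_r(x₀))`). [folklore] -/
theorem localMass_le_sq_sqrt_add (uT ut : EuclideanSpace ℝ (Fin 3) → EuclideanSpace ℝ (Fin 3))
    (hT : MemLp uT 2 volume) (ht : MemLp ut 2 volume) (x₀ : EuclideanSpace ℝ (Fin 3)) (r : ℝ)
    {H B : ℝ} (hH : 0 ≤ H) (hB : 0 ≤ B)
    (hmod : ∫⁻ x, ‖ut x - uT x‖ₑ ^ 2 ≤ ENNReal.ofReal H)
    (hloc : ∫ x in ball x₀ r, ‖ut x‖ ^ 2 ≤ B) :
    ∫ x in ball x₀ r, ‖uT x‖ ^ 2 ≤ (Real.sqrt H + Real.sqrt B) ^ 2 := by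
  set μB : Measure (EuclideanSpace ℝ (Fin 3)) := volume.restrict (ball x₀ r) with hμB
  have htri : eLpNorm uT 2 μB ≤ eLpNorm (uT - ut) 2 μB + eLpNorm ut 2 μB := by
    have h := eLpNorm_add_le (hT.1.restrict.sub ht.1.restrict) ht.1.restrict (p := 2)
      (by norm_num) (μ := μB)
    simpa only [sub_add_cancel] using h
  have hmodB : eLpNorm (uT - ut) 2 μB ≤ ENNReal.ofReal (Real.sqrt H) := by
    rw [PowerGaugeEulerLiouville.Backward.eLpNorm_two_eq_sqrt, Real.sqrt_eq_rpow,
      ← ENNReal.ofReal_rpow_of_nonneg hH (by norm_num)]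
    refine ENNReal.rpow_le_rpow ?_ (by norm_num)
    calc ∫⁻ y, ‖(uT - ut) y‖ₑ ^ 2 ∂μB ≤ ∫⁻ y, ‖(uT - ut) y‖ₑ ^ 2 :=
          lintegral_mono' Measure.restrict_le_self le_rfl
      _ = ∫⁻ y, ‖ut y - uT y‖ₑ ^ 2 := by
          refine lintegral_congr fun y => ?_
          rw [Pi.sub_apply, ← enorm_neg, neg_sub]
      _ ≤ ENNReal.ofReal H := hmod
  have hlocE : ∫⁻ y, ‖ut y‖ₑ ^ 2 ∂μB ≤ ENNReal.ofReal B := by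
    have hfin : ∫⁻ y, ‖ut y‖ₑ ^ 2 ∂μB ≠ ⊤ := by
      refine ne_top_of_le_ne_top (b := ∫⁻ y, ‖ut y‖ₑ ^ 2) ?_
        (lintegral_mono' Measure.restrict_le_self le_rfl)
      rw [lintegral_enorm_sq_eq_ofReal_integral ut ht]
      exact ENNReal.ofReal_ne_top
    rw [← ENNReal.ofReal_toReal hfin]
    refine ENNReal.ofReal_le_ofReal ?_
    rw [hμB, ← setIntegral_norm_sq_eq_toReal ut ht (ball x₀ r)]
    exact hloc
  have hsB : eLpNorm ut 2 μB ≤ ENNReal.ofReal (Real.sqrt B) := by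
    rw [PowerGaugeEulerLiouville.Backward.eLpNorm_two_eq_sqrt, Real.sqrt_eq_rpow,
      ← ENNReal.ofReal_rpow_of_nonneg hB (by norm_num)]
    exact ENNReal.rpow_le_rpow hlocE (by norm_num)
  have hsum : eLpNorm uT 2 μB ≤ ENNReal.ofReal (Real.sqrt H + Real.sqrt B) := by
    rw [ENNReal.ofReal_add (Real.sqrt_nonneg _) (Real.sqrt_nonneg _)]
    exact htri.trans (add_le_add hmodB hsB)
  have hsq : ∫⁻ y, ‖uT y‖ₑ ^ 2 ∂μB ≤ ENNReal.ofReal ((Real.sqrt H + Real.sqrt B) ^ 2) := by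
    have h := PowerGaugeEulerLiouville.Backward.lintegral_enorm_sq_le_of_eLpNorm_le hsum
    rwa [← ENNReal.ofReal_pow (add_nonneg (Real.sqrt_nonneg _) (Real.sqrt_nonneg _))] at h
  rw [setIntegral_norm_sq_eq_toReal uT hT (ball x₀ r)]
  exact ENNReal.toReal_le_of_le_ofReal (sq_nonneg _) hsq

/-- ★ **LOCAL ENERGY RELEASE INTO THE WINDOW** (the `b`-free local form of the energy-drop-versus-
modulus bound `EnergyDrop.stub_energyDrop_le_modulus_proof`): for `L²` fields `uT, ut` of `ℝ³` with
`∫⁻‖ut − uT‖ₑ² ≤ H`, on every ball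
`∫_{B_r(x₀)}‖ut‖² − ∫_{B_r(x₀)}‖uT‖² ≤ H + 2√H·(∫_{B_r(x₀)}‖uT‖²)^{1/2}` — the local energy that a
window slice `u(t)` can release above the terminal profile `u(T)` inside `B_r(x₀)` is paid by the
window modulus and the terminal local mass only. [folklore] -/
theorem localRelease_le (uT ut : EuclideanSpace ℝ (Fin 3) → EuclideanSpace ℝ (Fin 3))
    (hT : MemLp uT 2 volume) (ht : MemLp ut 2 volume) (x₀ : EuclideanSpace ℝ (Fin 3)) (r : ℝ)
    {H : ℝ} (hH : 0 ≤ H) (hmod : ∫⁻ x, ‖ut x - uT x‖ₑ ^ 2 ≤ ENNReal.ofReal H) :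
    (∫ x in ball x₀ r, ‖ut x‖ ^ 2) - ∫ x in ball x₀ r, ‖uT x‖ ^ 2 ≤
      H + 2 * Real.sqrt H * Real.sqrt (∫ x in ball x₀ r, ‖uT x‖ ^ 2) := by
  obtain ⟨m, hmdef⟩ : ∃ m : ℝ, m = ∫ x in ball x₀ r, ‖uT x‖ ^ 2 := ⟨_, rfl⟩
  have hm : 0 ≤ m := by rw [hmdef]; exact integral_nonneg fun _ => sq_nonneg _
  have hmod' : ∫⁻ x, ‖uT x - ut x‖ₑ ^ 2 ≤ ENNReal.ofReal H := by
    have h1 : ∫⁻ x, ‖uT x - ut x‖ₑ ^ 2 = ∫⁻ x, ‖ut x - uT x‖ₑ ^ 2 := by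
      refine lintegral_congr fun x => ?_
      rw [← enorm_neg, neg_sub]
    rw [h1]
    exact hmod
  have h := localMass_le_sq_sqrt_add ut uT ht hT x₀ r hH hm hmod' (by rw [hmdef])
  rw [← hmdef]
  have hex : (Real.sqrt H + Real.sqrt m) ^ 2 = H + 2 * Real.sqrt H * Real.sqrt m + m := by
    rw [add_sq, Real.sq_sqrt hH, Real.sq_sqrt hm]
  linarith

/-- ★ **STℓ — the LOCAL free-window scar–modulus trade-off** on the classical Leray–Hopf frame
(classical on `[0,T)`, Leray–Hopf on `[0,T]`; the decay hypothesis is carried, unused): a window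
modulus `∫|u(t)−u(T)|² ≤ H` on `[T−τ,T)` and a LOCAL DISSIPATION BUDGET
`ν ∫_{T−τ}^{T} ∫_{B_ρ(x₀)} |∇u|²_F ≤ L` give, for `0 < r`, `4r ≤ ρ`, `0 < τ < T`,
`∫_{B_r(x₀)}|u(T)|² ≤ 2H + 16(r²/(ντ))·L + c₀(r/ρ)²(H + ∫_{B_ρ(x₀)}|u(T)|²)`, one universal `c₀ ≥ 0`.
(`L` is a hypothesis NUMBER like `H`; its discharge by the local energy inequality — local energy
release plus cubic and pressure fluxes through the annulus — is not part of this lemma.) [folklore] -/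
theorem localWindowTradeoff : ∃ c₀ : ℝ, 0 ≤ c₀ ∧
    ∀ (ν T : ℝ), 0 < ν → 0 < T →
    ∀ (u : ℝ → EuclideanSpace ℝ (Fin 3) → EuclideanSpace ℝ (Fin 3))
      (p : ℝ → EuclideanSpace ℝ (Fin 3) → ℝ),
      Literature.Analysis.FluidPDE.IsClassicalNSSolutionOn (Set.Ico 0 T) ν 0 u p →
      Literature.Analysis.FluidPDE.IsLerayHopfOn T ν 0 (u 0) u →
      Literature.Analysis.FluidPDE.HasRapidSpatialDecay (u 0) →
      ∀ (x₀ : EuclideanSpace ℝ (Fin 3)) (r ρ τ H L : ℝ),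
        0 < r → 4 * r ≤ ρ → 0 < τ → τ < T → 0 ≤ H → 0 ≤ L →
        (∀ t ∈ Set.Ico (T - τ) T, ∫⁻ x, ‖u t x - u T x‖ₑ ^ 2 ≤ ENNReal.ofReal H) →
        (∫⁻ t in Set.Ioo (T - τ) T, ∫⁻ x in Metric.ball x₀ ρ,
            ENNReal.ofReal (frobeniusNormSq (fderiv ℝ (u t) x)) ≤ ENNReal.ofReal (L / ν)) →
        ∫ x in Metric.ball x₀ r, ‖u T x‖ ^ 2 ≤
          2 * H + 16 * (r ^ 2 / (ν * τ)) * L +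
            c₀ * (r / ρ) ^ 2 * (H + ∫ x in Metric.ball x₀ ρ, ‖u T x‖ ^ 2) := by
  obtain ⟨c₁, hc₁, hHardy⟩ := localHardyBall
  refine ⟨32 * c₁, by positivity, ?_⟩
  intro ν T hν hT u p hcl hLH _hdec x₀ r ρ τ H L hr hρ hτ hτT hH hL hmod hdiss
  have h1pos : 0 < T - τ := by linarith
  have hρ0 : 0 < ρ := by linarith
  have hν0 : ν ≠ 0 := hν.ne'
  have hτ0 : τ ≠ 0 := hτ.ne'
  have hr0 : r ≠ 0 := hr.ne'
  have hρ0' : ρ ≠ 0 := hρ0.ne'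
  -- the terminal local mass on the big ball
  obtain ⟨mρ, hmρdef⟩ : ∃ mρ : ℝ, mρ = ∫ x in ball x₀ ρ, ‖u T x‖ ^ 2 := ⟨_, rfl⟩
  have hmρ0 : 0 ≤ mρ := by rw [hmρdef]; exact integral_nonneg fun _ => sq_nonneg _
  have hmT : MemLp (u T) 2 volume := hLH.memLp T ⟨hT.le, le_rfl⟩
  rw [← hmρdef]
  -- remove `ε`
  refine le_of_forall_pos_le_add fun ε hε => ?_
  obtain ⟨δ, hδdef⟩ : ∃ δ : ℝ, δ = ε / (16 * r ^ 2) := ⟨_, rfl⟩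
  have hδ0 : 0 < δ := by rw [hδdef]; positivity
  -- a slice with small local enstrophy (mean value in time)
  obtain ⟨s, hs, hFs⟩ := exists_slice_lt
    (F := fun s => ∫⁻ x in ball x₀ ρ, ENNReal.ofReal (frobeniusNormSq (fderiv ℝ (u s) x)))
    (by linarith : T - τ < T) (by positivity : 0 ≤ L / ν) hδ0 hdiss
  have hwin : T - (T - τ) = τ := by ring
  rw [hwin] at hFs
  have hs0T : s ∈ Ico 0 T := ⟨(h1pos.trans hs.1).le, hs.2⟩
  have hms : MemLp (u s) 2 volume := hLH.memLp s ⟨hs0T.1, hs.2.le⟩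
  have hC1 : ContDiff ℝ 1 (u s) := (hcl.contDiff_velocity hs0T).of_le (by exact_mod_cast le_top)
  -- the local enstrophy of the slice as a real number `D ≤ L/(ντ) + δ`
  obtain ⟨D, hDdef⟩ : ∃ D : ℝ, D = ∫ x in ball x₀ ρ, frobeniusNormSq (fderiv ℝ (u s) x) :=
    ⟨_, rfl⟩
  have hDc : Continuous fun x => frobeniusNormSq (fderiv ℝ (u s) x) := by
    simp only [frobeniusNormSq]
    exact continuous_finsetSum _ fun i _ =>
      (((hC1.continuous_fderiv one_ne_zero).clm_apply continuous_const).norm.pow 2)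
  have hDi : Integrable (fun x => frobeniusNormSq (fderiv ℝ (u s) x))
      (volume.restrict (ball x₀ ρ)) :=
    (hDc.continuousOn.integrableOn_compact (isCompact_closedBall x₀ ρ)).mono_set
      ball_subset_closedBall
  have hDnn : ∀ x, 0 ≤ frobeniusNormSq (fderiv ℝ (u s) x) := fun x => frobeniusNormSq_nonneg _
  have hFD : (∫⁻ x in ball x₀ ρ, ENNReal.ofReal (frobeniusNormSq (fderiv ℝ (u s) x))) =
      ENNReal.ofReal D := by
    rw [hDdef, ofReal_integral_eq_lintegral_ofReal hDi (ae_of_all _ hDnn)]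
  have hDle : D ≤ L / ν / τ + δ := by
    have h := hFs.le
    rw [hFD] at h
    exact (ENNReal.ofReal_le_ofReal_iff (by positivity)).1 h
  -- local mass of the slice on `B_ρ(x₀)`: approximation principle with the roles swapped
  have hmodsw : ∫⁻ y, ‖u T y - u s y‖ₑ ^ 2 ≤ ENNReal.ofReal H := by
    have h1 : ∫⁻ y, ‖u T y - u s y‖ₑ ^ 2 = ∫⁻ y, ‖u s y - u T y‖ₑ ^ 2 := by
      refine lintegral_congr fun y => ?_
      rw [← enorm_neg, neg_sub]
    rw [h1]
    exact hmod s ⟨hs.1.le, hs.2⟩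
  have hmρs : ∫ x in ball x₀ ρ, ‖u s x‖ ^ 2 ≤ 2 * H + 2 * mρ :=
    SupRateClockScarLaw.scar_le_two_clock_add_two_localMass (u s) (u T) hms hmT x₀ ρ hH hmρ0
      hmodsw (by rw [hmρdef])
  -- local Hardy at the slice with `η = 1`
  have hH1 := hHardy (u s) hC1 x₀ r ρ 1 hr hρ one_pos
  rw [← hDdef, show (1 : ℝ) + 1 = 2 by norm_num, show (1 : ℝ) + 1⁻¹ = 2 by norm_num] at hH1
  obtain ⟨Bval, hBdef⟩ : ∃ Bval : ℝ,
      Bval = 4 * r ^ 2 * (2 * (L / ν / τ + δ) + 2 * (c₁ / ρ ^ 2) * (2 * H + 2 * mρ)) := ⟨_, rfl⟩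
  have hBval0 : 0 ≤ Bval := by rw [hBdef]; positivity
  have hloc : ∫ x in ball x₀ r, ‖u s x‖ ^ 2 ≤ Bval := by
    refine hH1.trans ?_
    rw [hBdef]
    have hcρ : 0 ≤ 2 * (c₁ / ρ ^ 2) := by positivity
    have h1 : 2 * D ≤ 2 * (L / ν / τ + δ) := by linarith
    have h2 : 2 * (c₁ / ρ ^ 2) * ∫ x in ball x₀ ρ, ‖u s x‖ ^ 2 ≤
        2 * (c₁ / ρ ^ 2) * (2 * H + 2 * mρ) := mul_le_mul_of_nonneg_left hmρs hcρ
    have hr2 : 0 ≤ 4 * r ^ 2 := by positivity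
    exact mul_le_mul_of_nonneg_left (add_le_add h1 h2) hr2
  -- approximation principle on `B_r(x₀)`
  have hmodT : ∫⁻ y, ‖u s y - u T y‖ₑ ^ 2 ≤ ENNReal.ofReal H := hmod s ⟨hs.1.le, hs.2⟩
  have hmain := SupRateClockScarLaw.scar_le_two_clock_add_two_localMass (u T) (u s) hmT hms x₀ r
    hH hBval0 hmodT hloc
  calc ∫ x in ball x₀ r, ‖u T x‖ ^ 2 ≤ 2 * H + 2 * Bval := hmain
    _ = 2 * H + 16 * (r ^ 2 / (ν * τ)) * L + 32 * c₁ * (r / ρ) ^ 2 * (H + mρ) + ε := by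
        rw [hBdef, hδdef]
        field_simp
        ring

end LocalWindowTradeoff

end Summit.NavierStokesRegularity.NavierStokesRegularity.Theorems

end
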